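import Literature.Analysis.Fourier.TransferCoefficients
import Mathlib.Analysis.Analytic.Uniqueness
import Mathlib.Tactic
import HarnessLib

/-!
# Taylor coefficients are determined by the germ

A bookkeeping complement to `TaylorOnClosedDisc` for the pullback computations of
Calegari–Dimitrov–Tang (arXiv:2408.15403, §6.4 eq. (6.16): the `𝐳^𝐧` coefficient of
`G = ⊗h · Φ^*F` is read off from the *germs* `f_i(φ_k(z)) = Σ_q a_{i,q} φ_k(z)^q` near `0`, while
the Cauchy-integral coefficients `taylorCoeff g R n` are computed on the circle `|z| = R`): if two
functions, holomorphic on closed discs (of possibly different radii), agree near `0`, their Taylor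
coefficients agree (`taylorCoeff_congr_of_eventuallyEq`), by uniqueness of power series expansions;
and `taylorCoeff g R n` does not depend on the admissible radius (`taylorCoeff_eq_of_le`).

No named facts.

## References

* [CalegariDimitrovTang2024] arXiv:2408.15403, §6.4 eq. (6.16).
-/

noncomputable section

open Complex Metric Filter

open scoped NNReal Topology

namespace Literature.Analysis.Fourier

namespace TorusCoeff

/-- The Cauchy power series of `g` on `|z| ≤ R` is its power series at `0`. [folklore] -/
theorem hasFPowerSeriesAt_cauchyPowerSeries {g : ℂ → ℂ} {R : ℝ≥0} (hR : 0 < R)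
    (hg : DifferentiableOn ℂ g (closedBall 0 R)) :
    HasFPowerSeriesAt g (cauchyPowerSeries g 0 R) 0 :=
  (hg.hasFPowerSeriesOnBall hR).hasFPowerSeriesAt

/-- **Germ determinacy**: functions holomorphic on closed discs which agree near `0` have the same
Taylor coefficients. [folklore] -/
theorem taylorCoeff_congr_of_eventuallyEq {g₁ g₂ : ℂ → ℂ} {R₁ R₂ : ℝ≥0} (hR₁ : 0 < R₁) (hR₂ : 0 < R₂)
    (hg₁ : DifferentiableOn ℂ g₁ (closedBall 0 R₁)) (hg₂ : DifferentiableOn ℂ g₂ (closedBall 0 R₂))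
    (heq : g₁ =ᶠ[𝓝 0] g₂) (n : ℕ) :
    taylorCoeff g₁ R₁ n = taylorCoeff g₂ R₂ n := by
  have h1 := hasFPowerSeriesAt_cauchyPowerSeries hR₁ hg₁
  have h2 := hasFPowerSeriesAt_cauchyPowerSeries hR₂ hg₂
  have h1' : HasFPowerSeriesAt g₂ (cauchyPowerSeries g₁ 0 R₁) 0 := h1.congr heq
  have hps : cauchyPowerSeries g₁ 0 R₁ = cauchyPowerSeries g₂ 0 R₂ := h1'.eq_formalMultilinearSeries h2
  unfold taylorCoeff
  rw [hps]

/-- The Taylor coefficients do not depend on the (admissible) radius. [folklore] -/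
theorem taylorCoeff_eq_of_le {g : ℂ → ℂ} {R₁ R₂ : ℝ≥0} (hR₁ : 0 < R₁) (hle : R₁ ≤ R₂)
    (hg : DifferentiableOn ℂ g (closedBall 0 R₂)) (n : ℕ) :
    taylorCoeff g R₁ n = taylorCoeff g R₂ n :=
  taylorCoeff_congr_of_eventuallyEq hR₁ (lt_of_lt_of_le hR₁ hle)
    (hg.mono (closedBall_subset_closedBall (by exact_mod_cast hle))) hg EventuallyEq.rfl n

/-- Consequently the transfer properties hold for any function agreeing with `Φ^μ h` near `0`
(e.g. after clearing denominators differently). [cite: CalegariDimitrovTang2024, §6.4 eq. (6.16)] -/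
theorem taylorCoeff_eq_zero_of_eventuallyEq_pow_mul {w Φ h : ℂ → ℂ} {Rw R : ℝ≥0} (hRw : 0 < Rw)
    (hR : 0 < R) (hw : DifferentiableOn ℂ w (closedBall 0 Rw))
    (hΦ : DifferentiableOn ℂ Φ (closedBall 0 R)) (hΦ0 : Φ 0 = 0)
    (hh : DifferentiableOn ℂ h (closedBall 0 R)) {μ r : ℕ} (hr : r < μ)
    (heq : w =ᶠ[𝓝 0] fun z => Φ z ^ μ * h z) :
    taylorCoeff w Rw r = 0 := by
  rw [taylorCoeff_congr_of_eventuallyEq hRw hR hw ((hΦ.pow μ).mul hh) heq r]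
  exact taylorCoeff_comp_pow_mul_of_lt hR hΦ hΦ0 hh hr

end TorusCoeff

end Literature.Analysis.Fourier
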